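/-
Copyright (c) 2026 the pub-hodgecm-mathlib formalisation cell (harness21).  Prover seat hodgecm-mathlib-K2E3-p11 (g2), Track B «K2-LIT» ∕ h413,
unit U12 «Characters» of the line `K2_E3_EllipticInputs`, socket #11 `sig_K2E3CharLocIntNearSemisimple` (and #12): THE SINGULAR SEMISIMPLE POINTS OF
`U_N(H)(L⁺_v)` — a scalar component makes an element central (every `N`), and at `N = 3` a non-regular semisimple element is central or of type `(2,1)` with
RATIONAL eigenvalues.  2026-09-04.
-/
import Summits.HodgeConjecture.HodgeConjecture.Theorems.K2E3CharLocIntNearSemisimpleTwoOfIdentity   -- ★ p855802 (this seat): the `N = 2` case, `exists_place_not_separable_of_not_isRegularElt` pattern; brings ★ `localSplitEquiv`, ★ subsingleton places, ★ semisimple transfer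
import HarnessLib

/-!
# K2_E3 road (h413 = stmt-HodgeConjecture-24833), unit U12 «Characters» — the singular semisimple points of `U_N(H)(L⁺_v)`: scalar components are central (all `N`);
# at `N = 3` a non-regular semisimple element is CENTRAL or of TYPE `(2,1)` with eigenvalues in `L_w`

Cell `pub/hodgecm-mathlib` (D-0151), Track B (21-frontier RULING «PUSH BOTH» 2026-09-03), socket module
`Summits/HodgeConjecture/HodgeConjecture/Cruxes/H413/Lines/K2_E3_EllipticInputsSigs_U12Characters.lean` (ED. 4), sockets #11 `sig_K2E3CharLocIntNearSemisimple` and #12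
`sig_K2E3NormalizedCharBddNearSemisimple` (both: «near every SEMISIMPLE `s`», general `N`).  `--supports stmt-HodgeConjecture-24833 --as helper`; theorems only — no `def`,
no named fact, no instance, no notation, no `sorry`.  Sequel of ★ p855802 `K2E3CharLocIntNearSemisimpleTwoOfIdentity` (which treats `N = 2`: a semisimple element is
regular or central).

WHY.  Harish-Chandra proves Thms 16.1∕16.3 at a semisimple `γ` by DESCENT to `M = Z_G(γ)` [HarishChandra1999, §18: `𝔤 = 𝔪 ⊕ 𝔮`, `(x, m) ↦ xγmx⁻¹`, `U_0 = (γU_M)^G`];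
the descent is empty iff `γ` is central.  This file records, in the sockets' currency (`G = (cmDatum L N H).Local v ≤ GL_N(Π_{w∣v} L_w)`, ★ `IsRegularElt` = separable
characteristic polynomial, semisimple = ★ `Module.End.IsSemisimple (toLin' s)`), WHICH points need a descent at `N = 3` — the organ's other instance (⚑1):
* §1 (pure algebra, any perfect field `K`, `n × n`): if the minimal polynomial of `M` has degree `≤ 1` then `M` is scalar; if `toLin' M` is semisimple then
  `minpoly M` is separable, so an INSEPARABLE `charpoly M` forces `deg minpoly M < n` [Borel1991, I.4 (4.2)–(4.4)]; for `n = 3` this leaves `deg minpoly M ∈ {1, 2}`,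
  and in degree `2` the cubic `charpoly M = minpoly M · (X − ν)` is inseparable only if `ν` is a root of `minpoly M`, whence
  **`minpoly M = (X − λ)(X − μ)`, `charpoly M = (X − λ)(X − μ)²`, `λ ≠ μ ∈ K`** (`exists_minpoly_eq_of_isSemisimple_of_not_separable_three`): the centraliser of `M` in
  `GL_3(K)` is `GL_1 × GL_2` over `K` itself — NO field extension (a double eigenvalue of a cubic over a field of characteristic `0` is rational).
* §2 (`U_N(H)(L⁺_v)`, every `N`, every finite place): **an element with a SCALAR component `s_{w₀} = a·1` is CENTRAL** (`mem_center_of_map_evalRingHom_eq_smul_one`):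
  at a place `w₀` moved by complex conjugation the projection `u ↦ u_{w₀}` is a group isomorphism onto `GL_N(L_{w₀})` (★ `localSplitEquiv`), and at a fixed `w₀`
  there is no other place above `v` (★ `PlacesOver.subsingleton_of_smul_eq`).  This is the general-`N` form of ★ p855802 §2.
* §3 (`N = 3`): **TRICHOTOMY** `isRegularElt_or_mem_center_or_type21`: a semisimple `s ∈ U_3(H)(L⁺_v)` is REGULAR, or CENTRAL, or of TYPE `(2,1)` at some place
  `w₀ ∣ v`: `minpoly(s_{w₀}) = (X − λ)(X − μ)`, `charpoly(s_{w₀}) = (X − λ)(X − μ)²` with `λ ≠ μ ∈ L_{w₀}` — the only points of `U_3` where rows #11∕#12 need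
  Harish-Chandra's descent, to `M = Z_G(s) ≅ U(2) × U(1)` (non-split `v`) resp. `GL₂ × GL₁ (L_w)` (split `v`), groups of the same kind over the same `L_w ∕ L⁺_v`.

* §1 `exists_eq_smul_one_of_natDegree_minpoly_le_one`, `natDegree_minpoly_lt_of_isSemisimple_of_not_separable`, **`exists_minpoly_eq_of_isSemisimple_of_not_separable_three`**.
* §2 `exists_place_not_separable_of_not_isRegularElt`, **`mem_center_of_map_evalRingHom_eq_smul_one`** (every `N`).
* §3 **`isRegularElt_or_mem_center_or_type21`** (`N = 3`).

HONEST LABEL: HC_CM is proved only modulo the 7 printed citations (2 remaining named inputs: hLiu418 = stmt-HodgeConjecture-24832, h413 =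
stmt-HodgeConjecture-24833) until rung 0 closes; this file is an unconditional `--supports` helper (structure of the singular set at `N = 3`) and proves no analytic
statement of rows #11∕#12.

## References
* [HarishChandra1999AdmissibleDistributions] Harish-Chandra (notes by S. DeBacker and P. J. Sally, Jr.), *Admissible Invariant Distributions on Reductive
  p-adic Groups*, AMS University Lecture Series 16 (1999), §18 pp. 78–79 (`M = Z_G(γ)`, `𝔤 = 𝔪 ⊕ 𝔮`), Thm. 16.1 p. 77.
* [Borel1991] A. Borel, *Linear Algebraic Groups*, 2nd ed., GTM 126 (1991), I.4 (4.2)–(4.4) (semisimple endomorphisms and minimal polynomials).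
* [Rogawski1990] J. D. Rogawski, *Automorphic Representations of Unitary Groups in Three Variables*, Ann. of Math. Stud. 123 (1990), §3.1 p. 19 (regular elements),
  §3.5–§3.6 (tori and centralisers of `U(3)`).
-/

set_option autoImplicit false
set_option linter.dupNamespace false

noncomputable section

open NumberField IsDedekindDomain Polynomial
open Literature.NumberTheory.Rogawski1990 Literature.NumberTheory.Automorphic
open scoped Matrix MatrixGroups

namespace Summit.HodgeConjecture.HodgeConjecture.Cruxes.H413.K2E3SemisimpleSingularThreeClassification

/-! ## §1  Field level -/

section Field

variable {K : Type*} [Field K] {n : Type*} [Fintype n] [DecidableEq n]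

/-- **A matrix whose minimal polynomial has degree `≤ 1` is scalar**: `minpoly M = X − λ` (it is monic of positive degree), so `M = λ·1`.
[cite: Borel1991, I.4 (4.2)–(4.4)] -/
theorem exists_eq_smul_one_of_natDegree_minpoly_le_one [Nonempty n] (M : Matrix n n K) (hle : (minpoly K M).natDegree ≤ 1) :
    ∃ a : K, M = a • (1 : Matrix n n K) := by
  have hmonic : (minpoly K M).Monic := minpoly.monic (Matrix.isIntegral M)
  have hpos : 0 < (minpoly K M).natDegree := minpoly.natDegree_pos (Matrix.isIntegral M)
  have h1 : (minpoly K M).natDegree = 1 := le_antisymm hle hpos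
  have hform : minpoly K M = X + C ((minpoly K M).coeff 0) := hmonic.eq_X_add_C h1
  have h0 : Polynomial.aeval M (minpoly K M) = 0 := minpoly.aeval K M
  rw [hform, map_add, Polynomial.aeval_X, Polynomial.aeval_C, Algebra.algebraMap_eq_smul_one] at h0
  refine ⟨-((minpoly K M).coeff 0), ?_⟩
  rw [neg_smul]
  exact eq_neg_of_add_eq_zero_left h0

variable [PerfectField K]

/-- **Over a perfect field, a SEMISIMPLE matrix with INSEPARABLE characteristic polynomial has `deg minpoly < n`**: `minpoly M` is squarefree (Mathlib
`Module.End.IsSemisimple.minpoly_squarefree`) hence separable, and divides `charpoly M` (degree `n`), so it cannot be all of it. [cite: Borel1991, I.4 (4.2)–(4.4)] -/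
theorem natDegree_minpoly_lt_of_isSemisimple_of_not_separable (M : Matrix n n K)
    (hs : Module.End.IsSemisimple (Matrix.toLin' M)) (hns : ¬ M.charpoly.Separable) : (minpoly K M).natDegree < Fintype.card n := by
  have hsq : Squarefree (minpoly K M) := by
    rw [← Matrix.minpoly_toLin']
    exact hs.minpoly_squarefree
  have hsep : (minpoly K M).Separable := PerfectField.separable_iff_squarefree.2 hsq
  have hdvd : minpoly K M ∣ M.charpoly := Matrix.minpoly_dvd_charpoly M
  have hmonic : (minpoly K M).Monic := minpoly.monic (Matrix.isIntegral M)
  have hcm : M.charpoly.Monic := Matrix.charpoly_monic M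
  have hdeg : M.charpoly.natDegree = Fintype.card n := Matrix.charpoly_natDegree_eq_dim M
  have hle : (minpoly K M).natDegree ≤ M.charpoly.natDegree := Polynomial.natDegree_le_of_dvd hdvd hcm.ne_zero
  rcases hle.lt_or_eq with hlt | heq'
  · rwa [hdeg] at hlt
  · exfalso
    have heq : M.charpoly = minpoly K M := Polynomial.eq_of_monic_of_dvd_of_natDegree_le hmonic hcm hdvd heq'.ge
    exact hns (heq ▸ hsep)

/-- **`3 × 3` TRICHOTOMY, field level**: over a perfect field, a semisimple `3 × 3` matrix `M` with inseparable characteristic polynomial is either SCALAR or of TYPE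
`(2,1)`: `minpoly M = (X − λ)(X − μ)` and `charpoly M = (X − λ)(X − μ)²` with `λ ≠ μ` IN THE GROUND FIELD.  (`deg minpoly M ∈ {1, 2}` by the previous lemma; in degree `2`
write `charpoly M = minpoly M · (X − μ)`: if `μ` were not a root of the separable `minpoly M` the product would be separable, so `minpoly M = (X − μ)(X − λ)`, and
`λ ≠ μ` because `minpoly M` is squarefree.) [cite: Borel1991, I.4 (4.2)–(4.4)] [cite: Rogawski1990, §3.5–§3.6] -/
theorem exists_minpoly_eq_of_isSemisimple_of_not_separable_three (M : Matrix (Fin 3) (Fin 3) K)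
    (hs : Module.End.IsSemisimple (Matrix.toLin' M)) (hns : ¬ M.charpoly.Separable) :
    (∃ a : K, M = a • (1 : Matrix (Fin 3) (Fin 3) K)) ∨
      ∃ lam mu : K, lam ≠ mu ∧ minpoly K M = (X - C lam) * (X - C mu) ∧ M.charpoly = (X - C lam) * (X - C mu) ^ 2 := by
  have hlt := natDegree_minpoly_lt_of_isSemisimple_of_not_separable M hs hns
  rw [Fintype.card_fin] at hlt
  by_cases h1 : (minpoly K M).natDegree ≤ 1
  · exact Or.inl (exists_eq_smul_one_of_natDegree_minpoly_le_one M h1)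
  · right
    have h2 : (minpoly K M).natDegree = 2 := by omega
    -- notation
    have hsq : Squarefree (minpoly K M) := by
      rw [← Matrix.minpoly_toLin']
      exact hs.minpoly_squarefree
    have hsep : (minpoly K M).Separable := PerfectField.separable_iff_squarefree.2 hsq
    have hmonic : (minpoly K M).Monic := minpoly.monic (Matrix.isIntegral M)
    have hcm : M.charpoly.Monic := Matrix.charpoly_monic M
    have hdeg : M.charpoly.natDegree = 3 := by rw [Matrix.charpoly_natDegree_eq_dim, Fintype.card_fin]
    -- `charpoly = minpoly * r`, `r` monic of degree `1`, `r = X - C mu`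
    obtain ⟨r, hr⟩ := Matrix.minpoly_dvd_charpoly M
    have hrm : r.Monic := hmonic.of_mul_monic_left (hr ▸ hcm)
    have hrdeg : r.natDegree = 1 := by
      have h := congrArg Polynomial.natDegree hr
      rw [hdeg, hmonic.natDegree_mul hrm, h2] at h
      omega
    set mu : K := -(r.coeff 0) with hmu
    have hrform : r = X - C mu := by
      rw [hrm.eq_X_add_C hrdeg, hmu, map_neg, sub_neg_eq_add]
    -- `mu` is a root of `minpoly M` (else `charpoly` would be separable)
    have hroot : (minpoly K M).IsRoot mu := by
      by_contra hnot
      apply hns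
      rw [hr, hrform]
      refine hsep.mul separable_X_sub_C ?_
      have hnd : ¬ (X - C mu) ∣ minpoly K M := fun h => hnot (dvd_iff_isRoot.1 h)
      exact ((irreducible_X_sub_C mu).coprime_iff_not_dvd.2 hnd).symm
    -- `minpoly = (X - C mu) * t`, `t = X - C lam`
    have hsplit : (X - C mu) * (minpoly K M /ₘ (X - C mu)) = minpoly K M := mul_divByMonic_eq_iff_isRoot.2 hroot
    set t := minpoly K M /ₘ (X - C mu) with ht
    have htm : t.Monic := (monic_X_sub_C mu).of_mul_monic_left (hsplit.symm ▸ hmonic)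
    have htdeg : t.natDegree = 1 := by
      have h := congrArg Polynomial.natDegree hsplit
      rw [(monic_X_sub_C mu).natDegree_mul htm, natDegree_X_sub_C, h2] at h
      omega
    set lam : K := -(t.coeff 0) with hlam
    have htform : t = X - C lam := by
      rw [htm.eq_X_add_C htdeg, hlam, map_neg, sub_neg_eq_add]
    have hmin : minpoly K M = (X - C lam) * (X - C mu) := by
      rw [← hsplit, htform, mul_comm]
    refine ⟨lam, mu, fun hlm => ?_, hmin, ?_⟩
    · -- `lam = mu` contradicts squarefreeness
      rw [hlm] at hmin
      have hunit : IsUnit (X - C mu) := hsq (X - C mu) ⟨1, by rw [mul_one, ← hmin]⟩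
      exact not_isUnit_X_sub_C mu hunit
    · rw [hr, hmin, hrform]
      ring

end Field

/-! ## §2  `U_N(H)(L⁺_v)`: an element with a scalar component is central (every `N`) -/

section Unitary

variable (L : Type) [Field L] [NumberField L] [IsCMField L] (N : ℕ) (H : Matrix (Fin N) (Fin N) L)
  (v : HeightOneSpectrum (𝓞 ↥(maximalRealSubfield L)))

omit [IsCMField L] in
open scoped Classical in
/-- If `s ∈ GL_N(Π_{w∣v} L_w)` is NOT regular, some component `s_{w₀} ∈ GL_N(L_{w₀})` has inseparable characteristic polynomial (★ `separable_iff_forall_map_evalRingHom`,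
`Matrix.charpoly_map`; general-`N` form of ★ p855802 `exists_place_not_separable_of_not_isRegularElt`). [cite: Rogawski1990, §3.1 p. 19] -/
theorem exists_place_not_separable_of_not_isRegularElt (s : GL (Fin N) (UnitaryGroup.LocalRing L v)) (hns : ¬ IsRegularElt s) :
    ∃ w₀ : UnitaryGroup.PlacesOver L v,
      ¬ (((s : Matrix (Fin N) (Fin N) (UnitaryGroup.LocalRing L v)).map
        (Pi.evalRingHom (fun w' : UnitaryGroup.PlacesOver L v => w'.1.adicCompletion L) w₀)).charpoly).Separable := by
  rw [isRegularElt_iff, Literature.Algebra.Polynomial.separable_iff_forall_map_evalRingHom] at hns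
  obtain ⟨w₀, hw₀⟩ := not_forall.1 hns
  exact ⟨w₀, by rwa [Matrix.charpoly_map]⟩

open scoped Classical in
/-- **AN ELEMENT OF `U_N(H)(L⁺_v)` WITH A SCALAR COMPONENT IS CENTRAL** (every `N`, every CM field `L`, every hermitian non-degenerate `H`, every finite place `v`):
if `s_{w₀} = a·1` in `GL_N(L_{w₀})` for some place `w₀ ∣ v`, then `s ∈ Z(U_N(H)(L⁺_v))`.  If complex conjugation moves `w₀` the projection `u ↦ u_{w₀}` is a group
isomorphism onto `GL_N(L_{w₀})` (★ `localSplitEquiv`) and carries `s` to a scalar matrix; if it fixes `w₀`, then `w₀` is the only place above `v`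
(★ `PlacesOver.subsingleton_of_smul_eq`) and `s` itself is scalar over `Π_w L_w = L_{w₀}`.  General-`N` form of ★ p855802 `mem_center_of_isSemisimple_of_not_isRegularElt`.
[cite: HarishChandra1999, §18 pp. 78–79] [cite: Rogawski1990, §3.1 p. 19] -/
theorem mem_center_of_map_evalRingHom_eq_smul_one (hH : (H.map (cmConjRingHom L))ᵀ = H) (hHd : H.det ≠ 0)
    (s : (UnitaryGroup.cmDatum L N H).Local v) (w₀ : UnitaryGroup.PlacesOver L v) (a : w₀.1.adicCompletion L)
    (ha : ((s.val : GL (Fin N) (UnitaryGroup.LocalRing L v)) : Matrix (Fin N) (Fin N) (UnitaryGroup.LocalRing L v)).map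
      (Pi.evalRingHom (fun w' : UnitaryGroup.PlacesOver L v => w'.1.adicCompletion L) w₀) = a • (1 : Matrix (Fin N) (Fin N) (w₀.1.adicCompletion L))) :
    s ∈ Subgroup.center ((UnitaryGroup.cmDatum L N H).Local v) := by
  have hc : IsCMField.complexConj L ≠ 1 := IsCMField.complexConj_ne_one L
  rw [Subgroup.mem_center_iff]
  intro g
  by_cases hw : IsCMField.complexConj L • w₀.1 = w₀.1
  · -- non-split: `w₀` is the only place above `v`
    haveI : Subsingleton (UnitaryGroup.PlacesOver L v) := UnitaryGroup.PlacesOver.subsingleton_of_smul_eq (IsCMField.complexConj L) hc w₀ hw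
    apply Subtype.ext
    change (g.val : GL (Fin N) (UnitaryGroup.LocalRing L v)) * s.val = s.val * g.val
    ext1
    rw [Units.val_mul, Units.val_mul]
    refine Matrix.ext fun i j => funext fun w => ?_
    obtain rfl : w = w₀ := Subsingleton.elim w w₀
    have hmul : ∀ A B : Matrix (Fin N) (Fin N) (UnitaryGroup.LocalRing L v),
        (A * B) i j w = ((A.map (Pi.evalRingHom (fun w' : UnitaryGroup.PlacesOver L v => w'.1.adicCompletion L) w)) *
          (B.map (Pi.evalRingHom (fun w' : UnitaryGroup.PlacesOver L v => w'.1.adicCompletion L) w))) i j := by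
      intro A B
      rw [← Matrix.map_mul]
      rfl
    rw [hmul, hmul, ha, mul_smul_comm, smul_mul_assoc, mul_one, one_mul]
  · -- split: `u ↦ u_{w₀}` is an isomorphism onto `GL_N(L_{w₀})`
    have hJw : IsUnit (UnitaryGroup.placeForm H w₀.1) :=
      UnitaryGroup.isUnit_placeForm H ((Matrix.isUnit_iff_isUnit_det H).2 (isUnit_iff_ne_zero.2 hHd)) w₀.1
    set e := UnitaryGroup.localSplitEquiv (IsCMField.complexConj L) H hc hH w₀ hw hJw with he
    have hemat : ((e s : GL (Fin N) (w₀.1.adicCompletion L)) : Matrix (Fin N) (Fin N) (w₀.1.adicCompletion L)) =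
        ((s.val : GL (Fin N) (UnitaryGroup.LocalRing L v)) : Matrix (Fin N) (Fin N) (UnitaryGroup.LocalRing L v)).map
          (Pi.evalRingHom (fun w' : UnitaryGroup.PlacesOver L v => w'.1.adicCompletion L) w₀) := by
      rw [he, UnitaryGroup.localSplitEquiv, ContinuousMulEquiv.trans_apply, UnitaryGroup.localPiSplitEquiv_apply,
        UnitaryGroup.coe_localPiEquiv_symm_apply, GLn.coe_piEquiv_apply]
    have hcomm : e g * e s = e s * e g := by
      ext1
      rw [Units.val_mul, Units.val_mul, hemat, ha, mul_smul_comm, smul_mul_assoc, mul_one, one_mul]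
    have h₁ : e (g * s) = e g * e s := map_mul e g s
    have h₂ : e (s * g) = e s * e g := map_mul e s g
    exact e.injective (h₁.trans (hcomm.trans h₂.symm))

end Unitary

/-! ## §3  `N = 3`: regular, central, or type `(2,1)` -/

section Three

variable (L : Type) [Field L] [NumberField L] [IsCMField L] (H : Matrix (Fin 3) (Fin 3) L)
  (v : HeightOneSpectrum (𝓞 ↥(maximalRealSubfield L)))

open scoped Classical in
/-- **TRICHOTOMY FOR THE SEMISIMPLE ELEMENTS OF `U_3(H)(L⁺_v)`**: a semisimple `s` is REGULAR, or CENTRAL, or of TYPE `(2,1)` at some place `w₀ ∣ v` —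
`minpoly(s_{w₀}) = (X − λ)(X − μ)` and `charpoly(s_{w₀}) = (X − λ)(X − μ)²` with `λ ≠ μ ∈ L_{w₀}` (so `Z(s_{w₀}) = GL(W_μ) × GL(W_λ) ≅ GL₂ × GL₁` over `L_{w₀}`; inside
`U_3` at a non-split `v`: `U(W_μ) × U(W_λ) ≅ U(2) × U(1)`).  Non-regular ⇒ some component has inseparable characteristic polynomial (★ p855802
`exists_place_not_separable_of_not_isRegularElt`); that component is semisimple (★ `isSemisimple_toLin'_map_evalRingHom`), hence scalar — then `s` is central by §2 —
or of type `(2,1)` (§1).  These type-`(2,1)` points are the only semisimple points of `U_3` at which rows #11∕#12 require Harish-Chandra's descent to `Z_G(s)`.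
[cite: HarishChandra1999, §18 pp. 78–79, Thm. 16.1 p. 77] [cite: Rogawski1990, §3.1 p. 19, §3.5–§3.6] [cite: Borel1991, I.4 (4.2)–(4.4)] -/
theorem isRegularElt_or_mem_center_or_type21 (hH : (H.map (cmConjRingHom L))ᵀ = H) (hHd : H.det ≠ 0)
    (s : (UnitaryGroup.cmDatum L 3 H).Local v)
    (hss : Module.End.IsSemisimple (Matrix.toLin' ((s.val : GL (Fin 3) (UnitaryGroup.LocalRing L v)).val : Matrix (Fin 3) (Fin 3) (UnitaryGroup.LocalRing L v)))) :
    IsRegularElt (s.val : GL (Fin 3) (UnitaryGroup.LocalRing L v)) ∨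
      s ∈ Subgroup.center ((UnitaryGroup.cmDatum L 3 H).Local v) ∨
      ∃ (w₀ : UnitaryGroup.PlacesOver L v) (lam mu : w₀.1.adicCompletion L), lam ≠ mu ∧
        minpoly (w₀.1.adicCompletion L) (((s.val : GL (Fin 3) (UnitaryGroup.LocalRing L v)) : Matrix (Fin 3) (Fin 3) (UnitaryGroup.LocalRing L v)).map
          (Pi.evalRingHom (fun w' : UnitaryGroup.PlacesOver L v => w'.1.adicCompletion L) w₀)) = (X - C lam) * (X - C mu) ∧
        (((s.val : GL (Fin 3) (UnitaryGroup.LocalRing L v)) : Matrix (Fin 3) (Fin 3) (UnitaryGroup.LocalRing L v)).map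
          (Pi.evalRingHom (fun w' : UnitaryGroup.PlacesOver L v => w'.1.adicCompletion L) w₀)).charpoly = (X - C lam) * (X - C mu) ^ 2 := by
  by_cases hreg : IsRegularElt (s.val : GL (Fin 3) (UnitaryGroup.LocalRing L v))
  · exact Or.inl hreg
  · right
    obtain ⟨w₀, hw₀⟩ := exists_place_not_separable_of_not_isRegularElt L 3 v s.val hreg
    haveI : CharZero (w₀.1.adicCompletion L) := charZero_of_injective_algebraMap (algebraMap L (w₀.1.adicCompletion L)).injective
    have hsw : Module.End.IsSemisimple (Matrix.toLin' (((s.val : GL (Fin 3) (UnitaryGroup.LocalRing L v)) : Matrix (Fin 3) (Fin 3) (UnitaryGroup.LocalRing L v)).map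
        (Pi.evalRingHom (fun w' : UnitaryGroup.PlacesOver L v => w'.1.adicCompletion L) w₀))) :=
      K2E3SemisimpleMatrixSurjectiveTransfer.isSemisimple_toLin'_map_evalRingHom _ hss w₀
    rcases exists_minpoly_eq_of_isSemisimple_of_not_separable_three _ hsw hw₀ with ⟨a, ha⟩ | ⟨lam, mu, hne, hmin, hchar⟩
    · exact Or.inl (mem_center_of_map_evalRingHom_eq_smul_one L 3 H v hH hHd s w₀ a ha)
    · exact Or.inr ⟨w₀, lam, mu, hne, hmin, hchar⟩

end Three

end Summit.HodgeConjecture.HodgeConjecture.Cruxes.H413.K2E3SemisimpleSingularThreeClassification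

end
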